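import Literature.MathematicalPhysics.QuantumFieldTheory.Balaban1983to89.B13WalksOfB9FactorsReading
import Literature.MathematicalPhysics.QuantumFieldTheory.Balaban1983to89.B13InverseLettersNeumann

/-!
# `Balaban1983to89.B13WalksOfB9FactorsReadingNeumann` — T. Bałaban, *Propagators for lattice gauge theories in a background field*, Commun.
Math. Phys. **99** (1985) 389–434 [Balaban1985BackgroundPropagators] («[13]» of [Balaban1988RG2Cluster]), (3.26)–(3.27) p. 395, Sect. B (3.60)–(3.65) p. 402
(«G′(U′U) = G′(U)(I − V′(A)G′(U))⁻¹ = Σₙ G′(U)(V′(A)G′(U))ⁿ») and p. 403 ll. 3–5 («Now applying Theorem 3.1 for G′(U), the bound (3.63), the representation (3.64)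
and Lemma 2.1 of [4] we can prove all the statements (3.42)–(3.47) of Theorem 3.1 for the operator G′(U′U), of course with different constants»), (3.86) p. 407,
Thm 3.10 (3.107)–(3.108) p. 416; *Renormalization group approach to lattice gauge field theories. II*, Commun. Math. Phys. **116** (1988) 1–22 [Balaban1988RG2Cluster] p. 13, p. 15:
THE N06 → N10 INVERSE ROAD ALONG A LOCATED SITE READING BY SECT. B's NEUMANN SERIES — module 58 (`B13InverseLettersNeumann.rawEntryLetters_inv_of_neumann`) fed with
N06's Theorem-3.10 CONCLUSION `Conv3107 𝔬 R H C δ U₀` and structure `Identities310 𝔬 R H U₀` at ONE background `U₀` read along a located reading of ANY [B9] geometry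
`g` (module 55A §2), plus the complexified operator's entry letters on the chart ball with `Aop 0 = M(𝔬.Δa U₀)`.  NO real structure, NO real family, NO two
constants, NO accretivity margin, NO lower bound — the geometry-generic Literature twin of module 58B (`Thm/…N10EntryLettersOfN06RecordFaceC`, which does this at
def-Y's members), and the torus-frame specialisation (module 33 ∕ 39's setting, identity reading).

statement-level bookkeeping over the landed modules 55A ∕ 58 with citation tags; kernel-checked; nothing here is a claim about the Yang–Mills mass gap;
nothing of Bałaban's operators is constructed or asserted; no node is discharged; count-neutral.

WHY THIS FILE (cell `pub-ymgap`, HUMAN RULING D-0062, Track A node N10 = [B13]; seat `pub-ymgap-dag-n10-c` g12, module 60; census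
`N10-RESIDUAL-CENSUS-v14.md`: the Neumann road = road of record for NODE A's inverse pieces).
* §1 ★★ `rawEntryLetters_inv_of_conv3107_neumann_reading` — any `g : B9.Geometry`, any located reading (`loc`, `sℓ ≥ 0`, `len ≤ ℓ_max`), ONE background.
* §2 ★ `rawEntryLetters_inv_of_conv3107_neumann_torus` — the identity reading of `torusGeom Nf η L M` (locations `blk`, rate `δ − 3μ`, constant `2Cη²`).
A2 ∕ A6.  N06's `Conv3107 ∕ Identities310` are N06's displayed content (GAPS G-B9-05∕06a∕07); the analytic block (`hAL`, `hslice0`-shape, fibre bound, rate,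
thin radius + smallness) is jointly inhabited with genuine `u`-dependence by `B13InverseLettersNeumann.rawEntryLetters_inv_of_neumann_toy`; the reading
hypotheses by §2's identity reading (and 57 §2).
HONEST FRAMING: hypotheses about N06's objects and the [II] p. 15 in-edge; NOTHING of Bałaban's constructed or asserted; neither N06 nor N10 discharged;
count-neutral; 0 `def`, 0 `sorry`; standard axioms; one finite 𝕋⁴ programme at fixed ε — nothing continuum ∕ OS ∕ mass gap ∕ Clay.
v1.0.1 (docstring-only; declarations byte-identical): the closing sentence of the Sect.-B quotation re-located to p. 403 ll. 3–5 and quoted verbatim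
(referee ref-B g23 READ-742 NIT-L1 on the sibling 58B; print checked first-hand).
-/

noncomputable section

namespace Literature.MathematicalPhysics.QuantumFieldTheory.Balaban1983to89.B13WalksOfB9FactorsReadingNeumann

open Metric Set Finset
open scoped Matrix
open Literature.MathematicalPhysics.QuantumFieldTheory.Balaban1983to89
open Literature.MathematicalPhysics.QuantumFieldTheory.Balaban1983to89.B9Thm37GlueTorus (tdist1 tdist1_nonneg torusGeom len_torusGeom)
open Literature.MathematicalPhysics.QuantumFieldTheory.Balaban1983to89.B5TorusCover (UT)
open Literature.MathematicalPhysics.QuantumFieldTheory.Balaban1983to89.B9Thm310Whole (Ops310 Identities310 Conv3107)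
open Literature.MathematicalPhysics.QuantumFieldTheory.Balaban1983to89.B13EntrywiseWalks (RawEntryLetters)
open Literature.MathematicalPhysics.QuantumFieldTheory.Balaban1983to89.B13InverseLettersNeumann (rawEntryLetters_inv_of_neumann_torus)
open Literature.MathematicalPhysics.QuantumFieldTheory.Balaban1983to89.B13WalksOfB9FactorsReading (rawEntryLetters_G_of_conv3107_reading)

variable {X : Type} [Fintype X] [DecidableEq X]
variable {ν : ℕ} {Nf : Fin ν → ℕ} [∀ i, NeZero (Nf i)]
variable {E : Type*} [NormedAddCommGroup E] [NormedSpace ℂ E]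

/-! ## §1. The inverse road along a located reading by the Neumann series: Theorem 3.10 at ONE background -/

section Ops

variable {g : B9.Geometry} [Fintype g.Site] [DecidableEq g.Site]
variable {Bg : B9.Backgrounds} {Y ι A : Type} [Fintype ι] [Fintype A]
variable (𝔬 : Ops310 g Bg X Y ι A) {Rr : ℝ} {H : Prop}

omit [DecidableEq g.Site] in
/-- ★★ **[B9] SECT. B's INVERSE ROAD ALONG A READING** (module 58 at N06's Theorem-3.10 conclusion for ONE background).  Inputs: N06's conclusion
`Conv3107 𝔬 R H C δ U₀` (the [4]-(2.51) majorant of `G(U₀)`) and structure `Identities310 𝔬 R H U₀` (for `Δ_a(U₀)·G(U₀) = 1`) at ONE background `U₀`; the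
located reading (`loc`, `sℓ ≥ 0` with `sℓ·d₁(loc a, loc b) ≤ dist a b`, `0 ≤ len ≤ ℓ_max`); the complexified operator `Aop : E → Matrix X X ℂ` with
`Aop 0 = M(𝔬.Δa U₀)` (`hslice0`) and entry letters `hAL : RawEntryLetters Aop (loc ∘ blk) R_an (δ·sℓ) B_A` on the chart ball ([II] p. 15 — displayed by its
owner); a fibre bound `mX` of `loc ∘ blk`; a rate `0 < μ` with `3μ ≤ δ·sℓ`; the thin radius `0 < R₁ ≤ R_an` with print's smallness
`2B_A·R₁∕R_an·(Cℓ_max²)·(mX·c₀(1,μ)^ν)² ≤ ½`.  Conclusion: `RawEntryLetters (u ↦ Aop(u)⁻¹)` on `‖u‖ < R₁`, locations `loc ∘ blk`, rate `δ·sℓ − 3μ`,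
constant `2·Cℓ_max²`.
[cite: Balaban1985BackgroundPropagators, (3.26)–(3.27) p.395, (3.60)–(3.65) p.402, (3.86) p.407, Thm 3.4 p.400, Thm 3.10 (3.107)–(3.108) p.416;
Balaban1984PropagatorsII, (2.51) p.232, Lemma 2.1 (2.61) p.234; Balaban1988RG2Cluster, p.13, p.15; Balaban1987RG1, (1.13)–(1.14) p.262] -/
theorem rawEntryLetters_inv_of_conv3107_neumann_reading {Aop : E → Matrix X X ℂ} {U₀ : Bg.Cfg}
    {Ran R₁ BA μ C δ ℓmax sℓ : ℝ} {mX : ℕ}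
    (hc : Conv3107 𝔬 Rr H C δ U₀) (hI : Identities310 𝔬 Rr H U₀) (hC : 0 ≤ C) (hδ : 0 ≤ δ)
    (hlen0 : ∀ a : g.Site, 0 ≤ g.len a) (hlen : ∀ a : g.Site, g.len a ≤ ℓmax)
    (loc : g.Site → UT Nf) (hloc : ∀ a b, sℓ * tdist1 Nf (loc a) (loc b) ≤ g.dist a b)
    (hslice0 : Aop 0 = (LinearMap.toMatrix' (𝔬.Δa U₀)).map (algebraMap ℝ ℂ))
    (hAL : RawEntryLetters Aop (loc ∘ 𝔬.blk) Ran (δ * sℓ) BA)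
    (hfibX : ∀ y : UT Nf, (univ.filter fun k => (loc ∘ 𝔬.blk) k = y).card ≤ mX)
    (hμ : 0 < μ) (h3μ : 3 * μ ≤ δ * sℓ) (hR₁ : 0 < R₁) (hR₁R : R₁ ≤ Ran)
    (hsmall : 2 * BA * R₁ / Ran * (C * ℓmax ^ 2) * (mX * B6.c0 1 μ ^ ν) * (mX * B6.c0 1 μ ^ ν) ≤ 1 / 2) :
    RawEntryLetters (fun u => (Aop u)⁻¹) (loc ∘ 𝔬.blk) R₁ (δ * sℓ - 3 * μ) (2 * (C * ℓmax ^ 2)) := by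
  -- the centre's letters (55A §2 at `U₀`) and `Δ_a(U₀)·G(U₀) = 1` ([B9] (3.27), N06's `Identities310.invT`) as complex matrices
  have hGL := rawEntryLetters_G_of_conv3107_reading (E := E) 𝔬 hc hC hδ hlen0 hlen loc hloc 1
  have hG : ∀ i j, ‖((LinearMap.toMatrix' (𝔬.G U₀)).map (algebraMap ℝ ℂ)) i j‖ ≤
      (C * ℓmax ^ 2) * Real.exp (-((δ * sℓ) * tdist1 Nf ((loc ∘ 𝔬.blk) i) ((loc ∘ 𝔬.blk) j))) :=
    fun i j => hGL.decay 0 (mem_ball_self one_pos) i j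
  have h0 : Aop 0 * (LinearMap.toMatrix' (𝔬.G U₀)).map (algebraMap ℝ ℂ) = 1 := by
    rw [hslice0, ← Matrix.map_mul, ← LinearMap.toMatrix'_mul, hI.invT, LinearMap.toMatrix'_one]
    exact Matrix.map_one _ (map_zero _) (map_one _)
  exact rawEntryLetters_inv_of_neumann_torus hAL h0 hG (mul_nonneg hC (sq_nonneg _)) hfibX hμ h3μ hR₁ hR₁R hsmall

end Ops

/-! ## §2. At the identity reading of the torus frame `torusGeom Nf η L M` (module 33 ∕ 39's setting) -/

section Torus

variable {η L M : ℝ}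
variable {Bg : B9.Backgrounds} {Y ι A : Type} [Fintype ι] [Fintype A]
variable (𝔬 : Ops310 (torusGeom Nf η L M) Bg X Y ι A) {Rr : ℝ} {H : Prop}

/-- ★ **SECT. B's INVERSE ROAD ON THE TORUS FRAME** (identity reading `loc = id`, `sℓ = 1`, `ℓ_max = η`, `η ≥ 0`): from N06's `Conv3107 ∕ Identities310` at
ONE background `U₀`, the complexified operator's letters `hAL` (rate `δ`) with `Aop 0 = M(Δ_a(U₀))`, a fibre bound of `blk`, `3μ ≤ δ`, the thin radius with
print's smallness ⟹ `RawEntryLetters (u ↦ Aop(u)⁻¹) blk R₁ (δ − 3μ) (2Cη²)`.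
[cite: Balaban1985BackgroundPropagators, (3.26)–(3.27) p.395, (3.41) p.397, (3.60)–(3.65) p.402, Thm 3.10 (3.107)–(3.108) p.416; Balaban1988RG2Cluster, p.13, p.15] -/
theorem rawEntryLetters_inv_of_conv3107_neumann_torus (hη : 0 ≤ η) {Aop : E → Matrix X X ℂ} {U₀ : Bg.Cfg}
    {Ran R₁ BA μ C δ : ℝ} {mX : ℕ}
    (hc : Conv3107 𝔬 Rr H C δ U₀) (hI : Identities310 𝔬 Rr H U₀) (hC : 0 ≤ C) (hδ : 0 ≤ δ)
    (hslice0 : Aop 0 = (LinearMap.toMatrix' (𝔬.Δa U₀)).map (algebraMap ℝ ℂ))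
    (hAL : RawEntryLetters Aop 𝔬.blk Ran δ BA)
    (hfibX : ∀ y : UT Nf, (univ.filter fun k => 𝔬.blk k = y).card ≤ mX)
    (hμ : 0 < μ) (h3μ : 3 * μ ≤ δ) (hR₁ : 0 < R₁) (hR₁R : R₁ ≤ Ran)
    (hsmall : 2 * BA * R₁ / Ran * (C * η ^ 2) * (mX * B6.c0 1 μ ^ ν) * (mX * B6.c0 1 μ ^ ν) ≤ 1 / 2) :
    RawEntryLetters (fun u => (Aop u)⁻¹) 𝔬.blk R₁ (δ - 3 * μ) (2 * (C * η ^ 2)) := by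
  have hloc : ∀ a b : (torusGeom Nf η L M).Site, 1 * tdist1 Nf (id a) (id b) ≤ (torusGeom Nf η L M).dist a b :=
    fun a b => by rw [one_mul]; exact le_rfl
  have hAL' : RawEntryLetters Aop (id ∘ 𝔬.blk) Ran (δ * 1) BA := by rw [mul_one]; exact hAL
  have h3μ' : 3 * μ ≤ δ * 1 := by rw [mul_one]; exact h3μ
  have h := rawEntryLetters_inv_of_conv3107_neumann_reading 𝔬 hc hI hC hδ (fun a => (len_torusGeom (N := Nf) η L M a).symm ▸ hη)
    (fun a => (len_torusGeom (N := Nf) η L M a).le) id hloc hslice0 hAL' hfibX hμ h3μ' hR₁ hR₁R hsmall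
  rw [mul_one] at h
  exact h

end Torus

end Literature.MathematicalPhysics.QuantumFieldTheory.Balaban1983to89.B13WalksOfB9FactorsReadingNeumann

end
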